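import Mathlib
import HarnessLib
import Literature.Probability.LatticeModels.ThermodynamicLimit

/-!
# Exponent bookkeeping: helper file `Aux2` for the stub `stub_pairExpectation` of line SketchIdeator1
(skeleton floor-russo), crux LowPointBookkeeping

Helper file for the crux skeleton `Cruxes/LowPointBookkeeping/Lines/SketchIdeator1.lean`
(item `stmt-CriticalPhenomena-14713`,
`Summit.CriticalPhenomena.PercolationContinuityZ3.Theses.PercLowPointHalfSpace.LowPointBookkeeping`),
stub `stub_pairExpectation`. Pure real analysis: the two real inequalities that turn the Markov
bounds of the dyadic classes into geometric series with total `O(L^{3-κ/2})` (`0 < κ ≤ 1/4`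
absorbs all logarithms). Only the box volume `|B_n| = (2n+1)^3` (`card_box`) is imported.

* `near_real` — near classes `2^j < 8L` (masses `m₀(2^{j+1}) ≤ |B_{2^{j+1}}|`, `m_e(20L) ≤ |B_{20L}|`,
  two-arm scale `m = min(2^j, L)`, thresholds `Λ C₂ n^{11/4}` with `Λ = 1 + 10 log L`):
  `Λ² C₂² (2^{j+1})^{11/4} (20L)^{11/4} C₁ m^{-(11/4+κ)} + |B_{2^{j+1}}| |B_{20L}| 2e^{3/2} e^{-Λ/2}
  ≤ K_near L^{3-κ/2} (2^{-κ})^j`, using `2^{j+1} ≤ 16 m`, `2^j ≤ 8 m` (so `m^{-κ} ≤ 2 (2^{-κ})^j`,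
  `rpow_neg_le_two_mul_geom`), `log L ≤ 16 L^{1/16}`, `e^{-Λ/2} = e^{-1/2} L^{-5}`.
* `far_real` — far classes `8L ≤ 2^j` (`r = 2^{j-1} ≥ 4L`, `n = 2^{j+1} = 4r`, window size
  `K ≤ (2L+1)^3`, threshold `T C₂ n^{11/4}` with `T = 1 + 8 log r`):
  `T C₂ n^{11/4} (K+1) C₁ r^{-(11/4+κ)} + |B_n| K e^{3/2} e^{-T/2} ≤ K_far L^{3-κ/2} (2^{-κ/4})^j`,
  using `log r ≤ (4/κ) r^{κ/4}`, `e^{-T/2} = e^{-1/2} r^{-4}`, `r^{-3κ/4} ≤ L^{-κ/2} · 2 (2^{-κ/4})^j`.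

The constants `K_near = 2·161²·16^{11/4}·20^{11/4} C₁ C₂² + 4 e^{3/2} 33³ 41³` and
`K_far = 2 (36·28·4^{11/4} C₁ C₂ / κ + 729·27 e^{3/2})` are crude; only their independence of
`L, j` (and of the floor density) matters.
-/

noncomputable section

namespace Summit.CriticalPhenomena.PercolationContinuityZ3.Theorems.FloorRusso.PairExpectation

open Literature.Probability.LatticeModels

/-- `M^{-κ} ≤ 2 (2^{-κ})^j` when `2^j ≤ 8M`, `M ≥ 1` and `0 < κ ≤ 1/4` (so that `8^κ ≤ 2`). -/
theorem rpow_neg_le_two_mul_geom {κ M : ℝ} (hκ : 0 < κ) (hκ4 : κ ≤ 1 / 4) (hM : 1 ≤ M) {j : ℕ}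
    (hjM : (2 : ℝ) ^ j ≤ 8 * M) : M ^ (-κ) ≤ 2 * ((2 : ℝ) ^ (-κ)) ^ j := by
  have hM0 : 0 < M := by linarith
  have hP0 : (0 : ℝ) < 2 ^ j := by positivity
  have hgeom : ((2 : ℝ) ^ (-κ)) ^ j = ((2 : ℝ) ^ j) ^ (-κ) := by
    rw [← Real.rpow_natCast, ← Real.rpow_mul (by norm_num), mul_comm, Real.rpow_mul (by norm_num),
      Real.rpow_natCast]
  have h8 : (8 : ℝ) ^ κ ≤ 2 := by
    have h : (8 : ℝ) ^ κ = 2 ^ (3 * κ) := by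
      rw [Real.rpow_mul (by norm_num)]
      congr 1
      rw [show (3 : ℝ) = ((3 : ℕ) : ℝ) by norm_num, Real.rpow_natCast]
      norm_num
    rw [h]
    calc (2 : ℝ) ^ (3 * κ) ≤ 2 ^ (1 : ℝ) :=
          Real.rpow_le_rpow_of_exponent_le (by norm_num) (by linarith)
      _ = 2 := Real.rpow_one 2
  have hPk : ((2 : ℝ) ^ j) ^ κ ≤ 2 * M ^ κ := by
    calc ((2 : ℝ) ^ j) ^ κ ≤ (8 * M) ^ κ := Real.rpow_le_rpow hP0.le hjM hκ.le
      _ = 8 ^ κ * M ^ κ := Real.mul_rpow (by norm_num) hM0.le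
      _ ≤ 2 * M ^ κ := by gcongr
  rw [hgeom, Real.rpow_neg hM0.le, Real.rpow_neg hP0.le, ← div_eq_mul_inv,
    le_div_iff₀ (Real.rpow_pos_of_pos hP0 κ), inv_mul_le_iff₀ (Real.rpow_pos_of_pos hM0 κ)]
  linarith

/-- **Near-class bookkeeping** (real inequality): for a near class `2^j < 8L`, the Markov bound
with thresholds `Λ C₂ n^{11/4}`, `Λ = 1 + 10 log L`, is `≤ K_near L^{3-κ/2} (2^{-κ})^j`. -/
theorem near_real {κ C₁ C₂ : ℝ} (hκ : 0 < κ) (hκ4 : κ ≤ 1 / 4) (hC₁ : 0 ≤ C₁) (hC₂ : 0 < C₂)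
    {L j : ℕ} (hL : 1 ≤ L) (hj : 2 ^ j < 8 * L) :
    (1 + 10 * Real.log L) * (C₂ * ((2 ^ (j + 1) : ℕ) : ℝ) ^ ((11 : ℝ) / 4)) *
          ((1 + 10 * Real.log L) * (C₂ * ((20 * L : ℕ) : ℝ) ^ ((11 : ℝ) / 4))) *
          (C₁ * ((min (2 ^ j) L : ℕ) : ℝ) ^ (-(11 / 4 + κ))) +
        ((box 3 (2 ^ (j + 1))).card : ℝ) * ((box 3 (20 * L)).card : ℝ) *
          (Real.exp (3 / 2) * Real.exp (-(1 + 10 * Real.log L) / 2) +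
            Real.exp (3 / 2) * Real.exp (-(1 + 10 * Real.log L) / 2)) ≤
      (2 * 161 ^ 2 * (16 : ℝ) ^ ((11 : ℝ) / 4) * (20 : ℝ) ^ ((11 : ℝ) / 4) * C₁ * C₂ ^ 2 +
          4 * Real.exp (3 / 2) * 33 ^ 3 * 41 ^ 3) *
        (L : ℝ) ^ (3 - κ / 2) * ((2 : ℝ) ^ (-κ)) ^ j := by
  -- natural-number facts about the dyadic class
  have hm1 : 1 ≤ min (2 ^ j) L := le_min Nat.one_le_two_pow hL
  have hmL : min (2 ^ j) L ≤ L := min_le_right _ _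
  have hnm : 2 ^ (j + 1) ≤ 16 * min (2 ^ j) L := by
    rcases le_total (2 ^ j) L with h | h
    · rw [min_eq_left h, pow_succ]; omega
    · rw [min_eq_right h, pow_succ]; omega
  have hjm : 2 ^ j ≤ 8 * min (2 ^ j) L := by
    rcases le_total (2 ^ j) L with h | h
    · rw [min_eq_left h]; omega
    · rw [min_eq_right h]; omega
  -- real versions
  set M : ℝ := ((min (2 ^ j) L : ℕ) : ℝ) with hMdef
  set N : ℝ := ((2 ^ (j + 1) : ℕ) : ℝ) with hNdef
  set X : ℝ := ((2 : ℝ) ^ (-κ)) ^ j with hXdef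
  have hL1 : (1 : ℝ) ≤ L := by exact_mod_cast hL
  have hL0 : (0 : ℝ) < L := by linarith
  have hM1 : 1 ≤ M := by rw [hMdef]; exact_mod_cast hm1
  have hM0 : 0 < M := by linarith
  have hML : M ≤ L := by rw [hMdef]; exact_mod_cast hmL
  have hNM : N ≤ 16 * M := by rw [hMdef, hNdef]; exact_mod_cast hnm
  have hN0 : 0 ≤ N := by rw [hNdef]; positivity
  have hPM : (2 : ℝ) ^ j ≤ 8 * M := by rw [hMdef]; exact_mod_cast hjm
  have hX0 : 0 ≤ X := by positivity
  have hMX : M ^ (-κ) ≤ 2 * X := rpow_neg_le_two_mul_geom hκ hκ4 hM1 hPM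
  have hLX : (L : ℝ) ^ (-κ) ≤ 2 * X :=
    rpow_neg_le_two_mul_geom hκ hκ4 hL1 (hPM.trans (by linarith))
  -- the threshold multiplier `Λ = 1 + 10 log L`
  set Λ : ℝ := 1 + 10 * Real.log L with hΛdef
  have hlog0 : 0 ≤ Real.log L := Real.log_nonneg hL1
  have hΛ1 : 1 ≤ Λ := by rw [hΛdef]; linarith
  have hΛ : Λ ≤ 161 * (L : ℝ) ^ ((1 : ℝ) / 16) := by
    have h1 := Real.log_le_rpow_div hL0.le (show (0 : ℝ) < 1 / 16 by norm_num)
    have h2 : 1 ≤ (L : ℝ) ^ ((1 : ℝ) / 16) := Real.one_le_rpow hL1 (by norm_num)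
    rw [hΛdef]
    have h3 : (L : ℝ) ^ ((1 : ℝ) / 16) / (1 / 16) = 16 * (L : ℝ) ^ ((1 : ℝ) / 16) := by ring
    linarith
  have hΛsq : Λ * Λ ≤ 161 ^ 2 * (L : ℝ) ^ ((1 : ℝ) / 8) := by
    have h : (L : ℝ) ^ ((1 : ℝ) / 16) * (L : ℝ) ^ ((1 : ℝ) / 16) = (L : ℝ) ^ ((1 : ℝ) / 8) := by
      rw [← Real.rpow_add hL0]; norm_num
    calc Λ * Λ ≤ (161 * (L : ℝ) ^ ((1 : ℝ) / 16)) * (161 * (L : ℝ) ^ ((1 : ℝ) / 16)) :=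
          mul_le_mul hΛ hΛ (by linarith) (by positivity)
      _ = 161 ^ 2 * (L : ℝ) ^ ((1 : ℝ) / 8) := by rw [← h]; ring
  -- `exp(-Λ/2) = exp(-1/2) L^{-5} ≤ L^{-5}`
  have hexp : Real.exp (-Λ / 2) ≤ (L : ℝ) ^ (-(5 : ℝ)) := by
    have h : -Λ / 2 = -1 / 2 + Real.log L * (-5) := by rw [hΛdef]; ring
    rw [h, Real.exp_add, ← Real.rpow_def_of_pos hL0]
    have h1 : Real.exp (-1 / 2) ≤ 1 := Real.exp_le_one_iff.2 (by norm_num)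
    have h2 : 0 ≤ (L : ℝ) ^ (-(5 : ℝ)) := by positivity
    nlinarith
  -- main term
  have hmain : Λ * (C₂ * N ^ ((11 : ℝ) / 4)) * (Λ * (C₂ * ((20 * L : ℕ) : ℝ) ^ ((11 : ℝ) / 4))) *
        (C₁ * M ^ (-(11 / 4 + κ))) ≤
      2 * 161 ^ 2 * (16 : ℝ) ^ ((11 : ℝ) / 4) * (20 : ℝ) ^ ((11 : ℝ) / 4) * C₁ * C₂ ^ 2 *
        (L : ℝ) ^ (3 - κ / 2) * X := by
    have h1 : N ^ ((11 : ℝ) / 4) * M ^ (-(11 / 4 + κ)) ≤ (16 : ℝ) ^ ((11 : ℝ) / 4) * (2 * X) := by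
      have hN : N ^ ((11 : ℝ) / 4) ≤ (16 : ℝ) ^ ((11 : ℝ) / 4) * M ^ ((11 : ℝ) / 4) := by
        rw [← Real.mul_rpow (by norm_num) hM0.le]
        exact Real.rpow_le_rpow hN0 hNM (by norm_num)
      have hM : M ^ ((11 : ℝ) / 4) * M ^ (-(11 / 4 + κ)) = M ^ (-κ) := by
        rw [← Real.rpow_add hM0]; ring_nf
      calc N ^ ((11 : ℝ) / 4) * M ^ (-(11 / 4 + κ))
          ≤ (16 : ℝ) ^ ((11 : ℝ) / 4) * M ^ ((11 : ℝ) / 4) * M ^ (-(11 / 4 + κ)) := by gcongr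
        _ = (16 : ℝ) ^ ((11 : ℝ) / 4) * M ^ (-κ) := by rw [mul_assoc, hM]
        _ ≤ (16 : ℝ) ^ ((11 : ℝ) / 4) * (2 * X) := by gcongr
    have h2 : ((20 * L : ℕ) : ℝ) ^ ((11 : ℝ) / 4) =
        (20 : ℝ) ^ ((11 : ℝ) / 4) * (L : ℝ) ^ ((11 : ℝ) / 4) := by
      push_cast
      exact Real.mul_rpow (by norm_num) hL0.le
    have h3 : (L : ℝ) ^ ((1 : ℝ) / 8) * (L : ℝ) ^ ((11 : ℝ) / 4) ≤ (L : ℝ) ^ (3 - κ / 2) := by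
      rw [← Real.rpow_add hL0]
      exact Real.rpow_le_rpow_of_exponent_le hL1 (by linarith)
    calc Λ * (C₂ * N ^ ((11 : ℝ) / 4)) * (Λ * (C₂ * ((20 * L : ℕ) : ℝ) ^ ((11 : ℝ) / 4))) *
          (C₁ * M ^ (-(11 / 4 + κ)))
        = C₁ * C₂ ^ 2 * (Λ * Λ) * ((20 : ℝ) ^ ((11 : ℝ) / 4) * (L : ℝ) ^ ((11 : ℝ) / 4)) *
            (N ^ ((11 : ℝ) / 4) * M ^ (-(11 / 4 + κ))) := by rw [h2]; ring
      _ ≤ C₁ * C₂ ^ 2 * (161 ^ 2 * (L : ℝ) ^ ((1 : ℝ) / 8)) *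
            ((20 : ℝ) ^ ((11 : ℝ) / 4) * (L : ℝ) ^ ((11 : ℝ) / 4)) *
            ((16 : ℝ) ^ ((11 : ℝ) / 4) * (2 * X)) := by gcongr
      _ = 2 * 161 ^ 2 * (16 : ℝ) ^ ((11 : ℝ) / 4) * (20 : ℝ) ^ ((11 : ℝ) / 4) * C₁ * C₂ ^ 2 *
            ((L : ℝ) ^ ((1 : ℝ) / 8) * (L : ℝ) ^ ((11 : ℝ) / 4)) * X := by ring
      _ ≤ 2 * 161 ^ 2 * (16 : ℝ) ^ ((11 : ℝ) / 4) * (20 : ℝ) ^ ((11 : ℝ) / 4) * C₁ * C₂ ^ 2 *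
            (L : ℝ) ^ (3 - κ / 2) * X := by gcongr
  -- tail term
  have htail : ((box 3 (2 ^ (j + 1))).card : ℝ) * ((box 3 (20 * L)).card : ℝ) *
        (Real.exp (3 / 2) * Real.exp (-Λ / 2) + Real.exp (3 / 2) * Real.exp (-Λ / 2)) ≤
      4 * Real.exp (3 / 2) * 33 ^ 3 * 41 ^ 3 * (L : ℝ) ^ (3 - κ / 2) * X := by
    have hA : ((box 3 (2 ^ (j + 1))).card : ℝ) ≤ (33 * L) ^ 3 := by
      rw [card_box]
      push_cast
      have hN' : (2 : ℝ) ^ (j + 1) = N := by rw [hNdef]; push_cast; ring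
      have h : (2 : ℝ) * 2 ^ (j + 1) + 1 ≤ 33 * L := by rw [hN']; nlinarith
      exact pow_le_pow_left₀ (by positivity) h 3
    have hB : ((box 3 (20 * L)).card : ℝ) ≤ (41 * L) ^ 3 := by
      rw [card_box]
      push_cast
      exact pow_le_pow_left₀ (by positivity) (by linarith) 3
    have hL6 : ((33 : ℝ) * L) ^ 3 * ((41 : ℝ) * L) ^ 3 * (L : ℝ) ^ (-(5 : ℝ)) =
        33 ^ 3 * 41 ^ 3 * L := by
      have h : (L : ℝ) ^ (-(5 : ℝ)) = ((L : ℝ) ^ 5)⁻¹ := by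
        rw [Real.rpow_neg hL0.le, show (5 : ℝ) = ((5 : ℕ) : ℝ) by norm_num, Real.rpow_natCast]
      rw [h]
      field_simp
    have hLX' : (L : ℝ) ≤ 2 * (L : ℝ) ^ (3 - κ / 2) * X := by
      have h1 : (L : ℝ) = (L : ℝ) ^ (1 + κ) * (L : ℝ) ^ (-κ) := by
        rw [← Real.rpow_add hL0]; simp
      have h2 : (L : ℝ) ^ (1 + κ) ≤ (L : ℝ) ^ (3 - κ / 2) :=
        Real.rpow_le_rpow_of_exponent_le hL1 (by linarith)
      calc (L : ℝ) = (L : ℝ) ^ (1 + κ) * (L : ℝ) ^ (-κ) := h1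
        _ ≤ (L : ℝ) ^ (3 - κ / 2) * (2 * X) := mul_le_mul h2 hLX (by positivity) (by positivity)
        _ = 2 * (L : ℝ) ^ (3 - κ / 2) * X := by ring
    calc ((box 3 (2 ^ (j + 1))).card : ℝ) * ((box 3 (20 * L)).card : ℝ) *
          (Real.exp (3 / 2) * Real.exp (-Λ / 2) + Real.exp (3 / 2) * Real.exp (-Λ / 2))
        = 2 * Real.exp (3 / 2) * (((box 3 (2 ^ (j + 1))).card : ℝ) *
            ((box 3 (20 * L)).card : ℝ) * Real.exp (-Λ / 2)) := by ring
      _ ≤ 2 * Real.exp (3 / 2) * ((33 * L) ^ 3 * (41 * L) ^ 3 * (L : ℝ) ^ (-(5 : ℝ))) := by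
          gcongr
      _ = 2 * Real.exp (3 / 2) * 33 ^ 3 * 41 ^ 3 * L := by rw [hL6]; ring
      _ ≤ 2 * Real.exp (3 / 2) * 33 ^ 3 * 41 ^ 3 * (2 * (L : ℝ) ^ (3 - κ / 2) * X) := by gcongr
      _ = 4 * Real.exp (3 / 2) * 33 ^ 3 * 41 ^ 3 * (L : ℝ) ^ (3 - κ / 2) * X := by ring
  calc Λ * (C₂ * N ^ ((11 : ℝ) / 4)) * (Λ * (C₂ * ((20 * L : ℕ) : ℝ) ^ ((11 : ℝ) / 4))) *
          (C₁ * M ^ (-(11 / 4 + κ))) +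
        ((box 3 (2 ^ (j + 1))).card : ℝ) * ((box 3 (20 * L)).card : ℝ) *
          (Real.exp (3 / 2) * Real.exp (-Λ / 2) + Real.exp (3 / 2) * Real.exp (-Λ / 2))
      ≤ _ := add_le_add hmain htail
    _ = _ := by ring

/-- **Far-class bookkeeping** (real inequality): for a far class `8L ≤ 2^j`, the one-factor Markov
bound with threshold `T C₂ n^{11/4}`, `T = 1 + 8 log 2^{j-1}`, is `≤ K_far L^{3-κ/2} (2^{-κ/4})^j`. -/
theorem far_real {κ C₁ C₂ : ℝ} (hκ : 0 < κ) (hκ4 : κ ≤ 1 / 4) (hC₁ : 0 ≤ C₁) (hC₂ : 0 < C₂)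
    {L j K : ℕ} (hL : 1 ≤ L) (hj : 8 * L ≤ 2 ^ j) (hK : K ≤ (2 * L + 1) ^ 3) :
    (1 + 8 * Real.log ((2 ^ (j - 1) : ℕ) : ℝ)) * (C₂ * ((2 ^ (j + 1) : ℕ) : ℝ) ^ ((11 : ℝ) / 4)) *
          ((K : ℝ) + 1) * (C₁ * ((2 ^ (j - 1) : ℕ) : ℝ) ^ (-(11 / 4 + κ))) +
        ((box 3 (2 ^ (j + 1))).card : ℝ) * (K : ℝ) *
          (Real.exp (3 / 2) * Real.exp (-(1 + 8 * Real.log ((2 ^ (j - 1) : ℕ) : ℝ)) / 2) + 0) ≤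
      (2 * (36 * 28 * (4 : ℝ) ^ ((11 : ℝ) / 4) * C₁ * C₂ / κ + 729 * 27 * Real.exp (3 / 2))) *
        (L : ℝ) ^ (3 - κ / 2) * ((2 : ℝ) ^ (-κ / 4)) ^ j := by
  -- natural-number facts about the dyadic class
  have hj1 : j ≠ 0 := by
    rintro rfl
    simp only [pow_zero] at hj
    omega
  have hpow : 2 ^ j = 2 * 2 ^ (j - 1) := by
    rw [← pow_succ']
    congr 1
    omega
  have hpow' : 2 ^ (j + 1) = 4 * 2 ^ (j - 1) := by rw [pow_succ, hpow]; ring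
  have hR4 : 4 * L ≤ 2 ^ (j - 1) := by omega
  -- real versions
  set R : ℝ := ((2 ^ (j - 1) : ℕ) : ℝ) with hRdef
  set Y : ℝ := ((2 : ℝ) ^ (-κ / 4)) ^ j with hYdef
  have hL1 : (1 : ℝ) ≤ L := by exact_mod_cast hL
  have hL0 : (0 : ℝ) < L := by linarith
  have hRL : 4 * (L : ℝ) ≤ R := by rw [hRdef]; exact_mod_cast hR4
  have hR1 : 1 ≤ R := by linarith
  have hR0 : 0 < R := by linarith
  have hLR : (L : ℝ) ≤ R := by linarith
  have hN : ((2 ^ (j + 1) : ℕ) : ℝ) = 4 * R := by rw [hRdef, hpow']; push_cast; ring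
  have hPj : (2 : ℝ) ^ j = 2 * R := by
    have h := congrArg (Nat.cast (R := ℝ)) hpow
    push_cast at h
    rw [h, hRdef]
    push_cast
    ring
  have hY0 : 0 ≤ Y := by positivity
  -- `R^{-κ/4} ≤ 2 Y`
  have hRY : R ^ (-κ / 4) ≤ 2 * Y := by
    have hYeq : Y = (2 * R) ^ (-κ / 4) := by
      rw [hYdef, ← hPj, ← Real.rpow_natCast, ← Real.rpow_mul (by norm_num), mul_comm,
        Real.rpow_mul (by norm_num), Real.rpow_natCast]
    rw [hYeq, Real.mul_rpow (by norm_num) hR0.le]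
    have h2 : (1 : ℝ) / 2 ≤ (2 : ℝ) ^ (-κ / 4) := by
      calc (1 : ℝ) / 2 = 2 ^ (-1 : ℝ) := by
            rw [Real.rpow_neg (by norm_num), Real.rpow_one]; norm_num
        _ ≤ 2 ^ (-κ / 4) := Real.rpow_le_rpow_of_exponent_le (by norm_num) (by linarith)
    have h3 : 0 ≤ R ^ (-κ / 4) := by positivity
    nlinarith
  -- threshold multiplier `T = 1 + 8 log R`
  set T : ℝ := 1 + 8 * Real.log R with hTdef
  have hlog0 : 0 ≤ Real.log R := Real.log_nonneg hR1
  have hT : T ≤ 36 / κ * R ^ (κ / 4) := by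
    have h1 := Real.log_le_rpow_div hR0.le (show 0 < κ / 4 by positivity)
    have h2 : 1 ≤ R ^ (κ / 4) := Real.one_le_rpow hR1 (by positivity)
    have h3 : (1 : ℝ) ≤ 4 / κ := by rw [le_div_iff₀ hκ]; linarith
    have h4 : R ^ (κ / 4) / (κ / 4) = 4 / κ * R ^ (κ / 4) := by
      field_simp
    have h5 : (1 : ℝ) ≤ 4 / κ * R ^ (κ / 4) := by nlinarith
    have h6 : Real.log R ≤ 4 / κ * R ^ (κ / 4) := by rw [← h4]; exact h1
    have h7 : T ≤ 4 / κ * R ^ (κ / 4) + 8 * (4 / κ * R ^ (κ / 4)) := by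
      rw [hTdef]; linarith
    calc T ≤ 4 / κ * R ^ (κ / 4) + 8 * (4 / κ * R ^ (κ / 4)) := h7
      _ = 36 / κ * R ^ (κ / 4) := by ring
  have hT0 : 0 ≤ T := by rw [hTdef]; positivity
  have hexp : Real.exp (-T / 2) ≤ R ^ (-(4 : ℝ)) := by
    have h : -T / 2 = -1 / 2 + Real.log R * (-4) := by rw [hTdef]; ring
    rw [h, Real.exp_add, ← Real.rpow_def_of_pos hR0]
    have h1 : Real.exp (-1 / 2) ≤ 1 := Real.exp_le_one_iff.2 (by norm_num)
    have h2 : 0 ≤ R ^ (-(4 : ℝ)) := by positivity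
    nlinarith
  have hK27 : (K : ℝ) ≤ 27 * (L : ℝ) ^ 3 := by
    have h1 : (K : ℝ) ≤ (2 * L + 1) ^ 3 := by exact_mod_cast hK
    have h2 : ((2 : ℝ) * L + 1) ^ 3 ≤ (3 * L) ^ 3 :=
      pow_le_pow_left₀ (by positivity) (by linarith) 3
    nlinarith
  have hK28 : (K : ℝ) + 1 ≤ 28 * (L : ℝ) ^ 3 := by
    have h : (1 : ℝ) ≤ (L : ℝ) ^ 3 := one_le_pow₀ hL1
    linarith
  -- main term
  have hmain : T * (C₂ * ((2 ^ (j + 1) : ℕ) : ℝ) ^ ((11 : ℝ) / 4)) * ((K : ℝ) + 1) *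
        (C₁ * R ^ (-(11 / 4 + κ))) ≤
      36 * 28 * (4 : ℝ) ^ ((11 : ℝ) / 4) * C₁ * C₂ / κ * (L : ℝ) ^ 3 * R ^ (-(3 * κ / 4)) := by
    have h1 : ((2 ^ (j + 1) : ℕ) : ℝ) ^ ((11 : ℝ) / 4) * R ^ (-(11 / 4 + κ)) =
        (4 : ℝ) ^ ((11 : ℝ) / 4) * R ^ (-κ) := by
      rw [hN, Real.mul_rpow (by norm_num) hR0.le, mul_assoc, ← Real.rpow_add hR0]
      ring_nf
    have h2 : R ^ (κ / 4) * R ^ (-κ) = R ^ (-(3 * κ / 4)) := by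
      rw [← Real.rpow_add hR0]; ring_nf
    calc T * (C₂ * ((2 ^ (j + 1) : ℕ) : ℝ) ^ ((11 : ℝ) / 4)) * ((K : ℝ) + 1) *
          (C₁ * R ^ (-(11 / 4 + κ)))
        = C₁ * C₂ * T * ((K : ℝ) + 1) *
            (((2 ^ (j + 1) : ℕ) : ℝ) ^ ((11 : ℝ) / 4) * R ^ (-(11 / 4 + κ))) := by ring
      _ = C₁ * C₂ * T * ((K : ℝ) + 1) * ((4 : ℝ) ^ ((11 : ℝ) / 4) * R ^ (-κ)) := by rw [h1]
      _ ≤ C₁ * C₂ * (36 / κ * R ^ (κ / 4)) * (28 * (L : ℝ) ^ 3) *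
            ((4 : ℝ) ^ ((11 : ℝ) / 4) * R ^ (-κ)) := by gcongr
      _ = 36 * 28 * (4 : ℝ) ^ ((11 : ℝ) / 4) * C₁ * C₂ / κ * (L : ℝ) ^ 3 *
            (R ^ (κ / 4) * R ^ (-κ)) := by ring
      _ = _ := by rw [h2]
  -- tail term
  have htail : ((box 3 (2 ^ (j + 1))).card : ℝ) * (K : ℝ) *
        (Real.exp (3 / 2) * Real.exp (-T / 2) + 0) ≤
      729 * 27 * Real.exp (3 / 2) * (L : ℝ) ^ 3 * R ^ (-(3 * κ / 4)) := by
    have hA : ((box 3 (2 ^ (j + 1))).card : ℝ) ≤ 729 * R ^ 3 := by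
      rw [card_box]
      push_cast
      have hN' : (2 : ℝ) ^ (j + 1) = 4 * R := by rw [← hN]; push_cast; ring
      rw [hN']
      have h : (2 : ℝ) * (4 * R) + 1 ≤ 9 * R := by linarith
      calc ((2 : ℝ) * (4 * R) + 1) ^ 3 ≤ (9 * R) ^ 3 := pow_le_pow_left₀ (by positivity) h 3
        _ = 729 * R ^ 3 := by ring
    have h1 : R ^ 3 * R ^ (-(4 : ℝ)) = R ^ (-(1 : ℝ)) := by
      rw [show (R ^ 3 : ℝ) = R ^ ((3 : ℕ) : ℝ) from (Real.rpow_natCast R 3).symm,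
        ← Real.rpow_add hR0]
      norm_num
    have h2 : R ^ (-(1 : ℝ)) ≤ R ^ (-(3 * κ / 4)) :=
      Real.rpow_le_rpow_of_exponent_le hR1 (by linarith)
    calc ((box 3 (2 ^ (j + 1))).card : ℝ) * (K : ℝ) * (Real.exp (3 / 2) * Real.exp (-T / 2) + 0)
        = Real.exp (3 / 2) * (((box 3 (2 ^ (j + 1))).card : ℝ) * (K : ℝ) *
            Real.exp (-T / 2)) := by ring
      _ ≤ Real.exp (3 / 2) * ((729 * R ^ 3) * (27 * (L : ℝ) ^ 3) * R ^ (-(4 : ℝ))) := by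
          gcongr
      _ = 729 * 27 * Real.exp (3 / 2) * (L : ℝ) ^ 3 * (R ^ 3 * R ^ (-(4 : ℝ))) := by ring
      _ ≤ 729 * 27 * Real.exp (3 / 2) * (L : ℝ) ^ 3 * R ^ (-(3 * κ / 4)) := by
          rw [h1]; gcongr
  -- `L^3 R^{-3κ/4} ≤ 2 L^{3-κ/2} Y`
  have hfin : (L : ℝ) ^ 3 * R ^ (-(3 * κ / 4)) ≤ 2 * (L : ℝ) ^ (3 - κ / 2) * Y := by
    have h1 : R ^ (-(3 * κ / 4)) = R ^ (-κ / 2) * R ^ (-κ / 4) := by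
      rw [← Real.rpow_add hR0]; ring_nf
    have h2 : R ^ (-κ / 2) ≤ (L : ℝ) ^ (-κ / 2) :=
      Real.rpow_le_rpow_of_nonpos hL0 hLR (by linarith)
    have h3 : (L : ℝ) ^ 3 * (L : ℝ) ^ (-κ / 2) = (L : ℝ) ^ (3 - κ / 2) := by
      rw [show ((L : ℝ) ^ 3) = (L : ℝ) ^ ((3 : ℕ) : ℝ) from (Real.rpow_natCast _ 3).symm,
        ← Real.rpow_add hL0]
      norm_num
      ring_nf
    calc (L : ℝ) ^ 3 * R ^ (-(3 * κ / 4)) = (L : ℝ) ^ 3 * (R ^ (-κ / 2) * R ^ (-κ / 4)) := by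
          rw [h1]
      _ ≤ (L : ℝ) ^ 3 * ((L : ℝ) ^ (-κ / 2) * (2 * Y)) := by gcongr
      _ = 2 * ((L : ℝ) ^ 3 * (L : ℝ) ^ (-κ / 2)) * Y := by ring
      _ = 2 * (L : ℝ) ^ (3 - κ / 2) * Y := by rw [h3]
  have hc : 0 ≤ 36 * 28 * (4 : ℝ) ^ ((11 : ℝ) / 4) * C₁ * C₂ / κ + 729 * 27 * Real.exp (3 / 2) := by
    positivity
  calc T * (C₂ * ((2 ^ (j + 1) : ℕ) : ℝ) ^ ((11 : ℝ) / 4)) * ((K : ℝ) + 1) *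
          (C₁ * R ^ (-(11 / 4 + κ))) +
        ((box 3 (2 ^ (j + 1))).card : ℝ) * (K : ℝ) * (Real.exp (3 / 2) * Real.exp (-T / 2) + 0)
      ≤ 36 * 28 * (4 : ℝ) ^ ((11 : ℝ) / 4) * C₁ * C₂ / κ * (L : ℝ) ^ 3 * R ^ (-(3 * κ / 4)) +
          729 * 27 * Real.exp (3 / 2) * (L : ℝ) ^ 3 * R ^ (-(3 * κ / 4)) := add_le_add hmain htail
    _ = (36 * 28 * (4 : ℝ) ^ ((11 : ℝ) / 4) * C₁ * C₂ / κ + 729 * 27 * Real.exp (3 / 2)) *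
          ((L : ℝ) ^ 3 * R ^ (-(3 * κ / 4))) := by ring
    _ ≤ (36 * 28 * (4 : ℝ) ^ ((11 : ℝ) / 4) * C₁ * C₂ / κ + 729 * 27 * Real.exp (3 / 2)) *
          (2 * (L : ℝ) ^ (3 - κ / 2) * Y) := by gcongr
    _ = _ := by ring

end Summit.CriticalPhenomena.PercolationContinuityZ3.Theorems.FloorRusso.PairExpectation

namespace Summit.CriticalPhenomena.PercolationContinuityZ3.Theorems.FloorRusso

/-- **stub_pairExpectationAux2** (registered sub-goal of this helper file): the dyadic comparison
`M^{-κ} ≤ 2 (2^{-κ})^j` for `2^j ≤ 8M`, `M ≥ 1`, `0 < κ ≤ 1/4`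
(`PairExpectation.rpow_neg_le_two_mul_geom`), which turns the class bounds into geometric series. -/
theorem stub_pairExpectationAux2 :
    ∀ {κ M : ℝ}, 0 < κ → κ ≤ 1 / 4 → 1 ≤ M → ∀ {j : ℕ}, (2 : ℝ) ^ j ≤ 8 * M →
      M ^ (-κ) ≤ 2 * ((2 : ℝ) ^ (-κ)) ^ j :=
  fun hκ hκ4 hM _ hjM => PairExpectation.rpow_neg_le_two_mul_geom hκ hκ4 hM hjM

end Summit.CriticalPhenomena.PercolationContinuityZ3.Theorems.FloorRusso

end
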